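import Literature.MathematicalPhysics.QuantumFieldTheory.Balaban1983to89.B9Thm313WholeBlocksPairMZCut

/-!
# `Balaban1983to89.B9Thm313WholeGGBlocksEntries` — T. Bałaban, *Propagators for lattice gauge theories in a background field*, Commun. Math. Phys. **99** (1985)
# 389–434 [`Balaban1985BackgroundPropagators`], Theorem 3.13 p. 426 (row 21): the block bounds and the L² block (3.46) of a kernel family co-read by 𝔊 AT THE 𝔊-ENTRY LINE —
# the three sup entries (3.42)₁,₂,₃ of 𝔊 are HYPOTHESES (one constant `C_sup`, rate ρ′); lines 3–5 from the L² letters as landed; NO step on a raw sup class is consumed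

[4] = T. Bałaban, *Propagators and renormalization transformations for lattice gauge theories. II*, Commun. Math. Phys. **96** (1984) 223–250 [`Balaban1984PropagatorsII`].
statement-level skeleton of published theorems with citation tags; proofs where landed; nothing here is a claim about the Yang–Mills mass gap.

THE PRINT.  Thm 3.13 p. 426; (3.46) p. 398 (the block-L² lines, by the Schur test from (3.42) and the scale transfer, and the pair lines from the L² letters); (3.39) p. 397.

WHY THIS FILE (cell `pub-ymgap`, node N06, bundle F7 rows 20–21, seat dag-n06-l g27; programme P-U8S step S5d).  `B9Thm313WholeBlocksPairMZCut.GG_blockBds_nbrZc ∕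
GG_l2Block_pairMZc` derive the three sup entries of 𝔊 INSIDE (`GG_entry0∕1_cut_of_letters`, `GG_entry2_of_lettersZc` — consumers of `Step.step1`, `LeftStep.stepD1`: LOCATED-U8′
species); everything else they use is L² letter algebra (`GG_l2bd_entry4Z`, `GG_l2bd_family3Zc∕5Zc`, `GG_l2bd_mixedFamily_cut_of_letters`, `l2bd_entry0∕12_of_sup`,
`l2line_of_blockBd_nbr`).  THIS FILE re-issues both CUT AT THE ENTRY LINE — ★★ `GG_blockBds_of_entries`, ★★ `GG_l2Block_of_entries` — with `hm0 hm1 hm2` (the entries at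
(`C_sup`, ρ′), e.g. from `B9Thm313WholeGGEntriesMembers` over the regular state) as hypotheses; the letters `Letters313Zc ∕ Letters313DZ ∕ Ids3152` and the raw steps are no
longer binders; proofs otherwise verbatim.
HONEST SCOPE.  Bookkeeping over hypothesis schemas of printed species; nothing of [B9]∕[4] asserted; no pin, no certificate edit; COUNT-NEUTRAL; N06 NOT discharged; nothing
continuum ∕ OS positivity ∕ mass gap.  Cell `pub-ymgap` (HUMAN RULING D-0062), Track A node N06 [B9], seat `pub-ymgap-dag-n06-l` (g27), 2026-08-29.  NEW file; nothing landed is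
modified.
-/

namespace Literature.MathematicalPhysics.QuantumFieldTheory.Balaban1983to89.B9Thm313WholeGGBlocksEntries

open Literature.MathematicalPhysics.QuantumFieldTheory.Balaban1983to89
open Finset B6RandomWalk B6RandomWalkHom B9Thm34Ext B9Thm37GlueCor36 B11SectG B9SectDSup B9Thm37AllNorms
open B9Thm37AllNormsInstances B9FromB6 B9SectBStepWhole B9Thm312Whole B9Thm312WholeLeaf B9Thm312WholeLeft B9Thm313Whole B9Thm313WholeLeft
open B9Thm37Glue B9SectDL2Decay B9RWSums343Holder B9RWSumsReadsRel B9RWSumsReadsNbr B9Ineq347 B9Thm312WholeClasses B9Thm312WholeL2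
open B9Thm312WholeBlocksRel B9Thm312WholeBlocksNbr B9Thm312WholeHolder B9Thm312WholeHHolder B9Thm313WholeHolder B9Thm313WholeL2G B9Thm313WholeL2GP B9Thm313WholeInput
open B9RWSums346SecondDiff B9Thm313WholeBlocksNbr B9Thm312WholeBlocksNbrRec B9Thm313WholeBlocksNbrRec B9RWSums344InputFam B9Thm312WholeDir B9Thm312WholeBlocksPairM B9Thm313WholeDir
open B9Thm313WholeDirInput B9Thm313WholeBlocksPairM B9Thm313WholeZ B9Thm313WholeLeftZ B9Thm313WholeHolderZ B9Thm313WholeInputZ B9Thm313WholeDirZ B9Thm313WholeDirInputZ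
open B9Thm313WholeDirInputBZ B9Thm313WholeL2GZ B9Thm313WholeL2GPZ B9Thm313WholeDirL2Z B9Thm313WholeBlocksPairMZ
open B9Thm313WholeRgdFrom3152 B9Thm313WholeLettersCut B9Thm313WholeCutCores B9Thm313WholeSupReadersCut B9Thm313WholeL2MixedCut

open B9Thm313WholeBlocksPairMZCut

noncomputable section

section OneMember

variable {g : B9.Geometry} {B : B9.Backgrounds} {X Y Z W PX PY P : Type}
variable [Fintype X] [Fintype Y] [Fintype Z] [Fintype W] [Fintype PX] [Fintype PY] [Fintype P] [Fintype g.Site] [DecidableEq g.Site]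
variable {R₀ : ℝ} {H₀ : Prop}

/-! ## §1 The six block bounds of 𝔊 at the entry line -/

omit [Fintype PX] [Fintype PY] [DecidableEq g.Site] in
/-- ★★ **THE SIX BLOCK BOUNDS OF 𝔊 AT THE ENTRY LINE** (`GG_blockBds_nbrZc` with the three sup entries of 𝔊 — `hm0` (C_sup·(Lʲη)²e^{−ρ′d}), `hm1` (∇_U𝔊), `hm2` (𝔊∇\*_U)
(C_sup·Lʲη·e^{−ρ′d}) — as HYPOTHESES): lines 0–2 by the Schur test and the scale transfer (`l2bd_entry0∕12_of_sup`), lines 3–5 from Theorem 3.3's L² schema, the L² step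
letter and the pair letters (`GG_l2bd_entry4Z`, `GG_l2bd_family3Zc ∕ 5Zc`), all brought to (K₆, δ).
[cite: Balaban1985BackgroundPropagators, Thm 3.13 p.426 + (3.46) p.398 + (3.39) p.397; Balaban1984PropagatorsII, (2.51)–(2.52) p.232 + Lemma 2.1 (2.60) p.234] -/
theorem GG_blockBds_of_entries (hG : GeoOK g) {𝔬 : Ops g B X Y Z W}
    {Dd Dds : B.Cfg → P → Module.End ℝ (X → ℝ)} {U : B.Cfg}
    {θ₂' B₂ B₄ ρ ρ' α σ c Csup KGu K6 Λ₁ Λh Λm Λu δ : ℝ}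
    (hrow : RowSum (toB6 g R₀ H₀) σ c) (hc : 0 ≤ c) (hθ₂' : 0 ≤ θ₂') (hB₂ : 0 ≤ B₂)
    (hB₄ : 0 ≤ B₄) (hσ : 0 ≤ σ) (hρ' : 0 < ρ') (hρ'ρ₅ : ρ' + 5 * σ ≤ ρ)
    (hq₂1 : B₂ * θ₂' * c * c < 1) (hδ1 : δ ≤ (1 - α) * ρ') (hδ2 : δ ≤ ρ')
    (hST1 : ScaleTransfer g ρ' α Λ₁ (fun y => g.len y ^ (1 : ℝ))) (hSTh : ScaleTransfer g ρ' α Λh (fun y => g.len y ^ (1 / 2 : ℝ)))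
    (hSTm : ScaleTransfer g ρ' α Λm (fun y => g.len y ^ (-1 : ℝ))) (hΛ₁0 : 0 ≤ Λ₁) (hΛ₁le : Λ₁ ≤ Λu) (hΛhle : Λh ≤ Λu)
    (hΛm0 : 0 ≤ Λm) (hΛmle : Λm ≤ Λu) (h1Λu : 1 ≤ Λu)
    (hCsup0 : 0 ≤ Csup)
    (hKGu0 : 0 ≤ KGu) (hKGle : constG46 (constKp B₂ B₄ θ₂' c) c ≤ KGu) (hK60 : 0 ≤ K6) (hK6a : Csup * Λu ≤ K6) (hK6b : KGu ≤ K6)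
    (hK6c : Real.sqrt (Fintype.card (P × P)) * (KGu * Λu) ≤ K6)
    (hm0 : HasMajorant (g := toB6 g R₀ H₀) 𝔬.blk (𝔬.GG U) (fun a b => Csup * g.len a ^ 2 * Real.exp (-(ρ' * g.dist a b))))
    (hm1 : HasMajorantHom (g := toB6 g R₀ H₀) 𝔬.blk 𝔬.blkY (𝔬.D U ∘ₗ 𝔬.GG U)
      (fun (a b : g.Site) => Csup * g.len a * Real.exp (-(ρ' * g.dist a b))))
    (hm2 : HasMajorantHom (g := toB6 g R₀ H₀) 𝔬.blkY 𝔬.blk (𝔬.GG U ∘ₗ 𝔬.Dstar U)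
      (fun (a b : g.Site) => Csup * g.len a * Real.exp (-(ρ' * g.dist a b))))
    (hI : Identities 𝔬 U)
    (hL2 : Thm33G0L2P 𝔬 Dd Dds R₀ H₀ B₂ ρ U)
    (hT : BlockBd (g := toB6 g R₀ H₀) 𝔬.blk 𝔬.blk (𝔬.Tpi U + 𝔬.T2 U)
      (fun (y y' : g.Site) => θ₂' * (g.len y)⁻¹ * (g.len y')⁻¹ * Real.exp (-(ρ * g.dist y y'))))
    {vZ : g.Site → ℝ} {hvZ : ∀ y, 0 < vZ y} (hLt : Letters313L2Pc 𝔬 Dd Dds R₀ H₀ B₄ ρ vZ hvZ U)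
    (hsym : IsTransposePair (𝔬.GG U) (𝔬.GG U)) (htr : IsTransposePair (𝔬.D U ∘ₗ 𝔬.GG U) (𝔬.GG U ∘ₗ 𝔬.Dstar U)) :
    BlockBd (g := toB6 g R₀ H₀) 𝔬.blk 𝔬.blk (𝔬.GG U)
        (fun (y y' : g.Site) => K6 * B9.pref6 (g.len y) 0 * Real.exp (-(δ * g.dist y y'))) ∧
      BlockBd (g := toB6 g R₀ H₀) 𝔬.blk 𝔬.blkY (𝔬.D U ∘ₗ 𝔬.GG U)
        (fun (y y' : g.Site) => K6 * B9.pref6 (g.len y) 1 * Real.exp (-(δ * g.dist y y'))) ∧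
      BlockBd (g := toB6 g R₀ H₀) 𝔬.blkY 𝔬.blk (𝔬.GG U ∘ₗ 𝔬.Dstar U)
        (fun (y y' : g.Site) => K6 * B9.pref6 (g.len y) 2 * Real.exp (-(δ * g.dist y y'))) ∧
      BlockBd (g := toB6 g R₀ H₀) 𝔬.blk (𝔬.blk ∘ Prod.fst) (familyOp (fun q : P × P => (Dd U q.1 ∘ₗ Dd U q.2) ∘ₗ 𝔬.GG U))
        (fun (y y' : g.Site) => K6 * B9.pref6 (g.len y) 3 * Real.exp (-(δ * g.dist y y'))) ∧
      BlockBd (g := toB6 g R₀ H₀) 𝔬.blkY 𝔬.blkY (𝔬.D U ∘ₗ (𝔬.GG U ∘ₗ 𝔬.Dstar U))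
        (fun (y y' : g.Site) => K6 * B9.pref6 (g.len y) 4 * Real.exp (-(δ * g.dist y y'))) ∧
      BlockBd (g := toB6 g R₀ H₀) 𝔬.blk (𝔬.blk ∘ Prod.fst) (familyOp (fun q : P × P => 𝔬.GG U ∘ₗ (Dds U q.1 ∘ₗ Dds U q.2)))
        (fun (y y' : g.Site) => K6 * B9.pref6 (g.len y) 5 * Real.exp (-(δ * g.dist y y'))) := by
  -- the body of `B9Thm313WholeBlocksPairMZCut.GG_blockBds_nbrZc` below the entry line
  set NP : ℝ := Real.sqrt (Fintype.card (P × P)) with hNP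
  have hNP0 : 0 ≤ NP := Real.sqrt_nonneg _
  have hlen := hG.lenle
  have hΛu0 : 0 ≤ Λu := zero_le_one.trans h1Λu
  -- lines 0, 1, 2 by the Schur test and the scale transfer, from the three sup entries of 𝔊 (hypotheses)
  have hb0 := l2bd_entry0_of_sup (R₀ := R₀) (H₀ := H₀) hG hCsup0 hST1 hm0 hsym
  obtain ⟨hb1, hb2⟩ := l2bd_entry12_of_sup (R₀ := R₀) (H₀ := H₀) hG hCsup0 hSTh hm1 hm2 htr
  -- lines 3, 4, 5 from the pair schemas (line 4 through the Laplacian-free projections)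
  have hb4 := GG_l2bd_entry4Z hG hrow hB₂ hB₄ hθ₂' hρ'.le hσ hρ'ρ₅ (Thm33G0L2P.toLap hB₂ hG.lenle hL2) hT
    (Letters313L2Pc.toLap hB₄ hG.lenle hLt) hI hq₂1
  have hb3 := GG_l2bd_family3Zc hG hrow hB₂ hB₄ hθ₂' hρ'.le hσ hρ'ρ₅ hΛ₁0 hST1 hL2 hT hLt hI hq₂1
  have hb5 := GG_l2bd_family5Zc hG hrow hB₂ hB₄ hθ₂' hρ'.le hσ hρ'ρ₅ hΛm0 hSTm hL2 hT hLt hI hq₂1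
  have hρα : ρ' - α * ρ' = (1 - α) * ρ' := by ring
  rw [hρα] at hb3 hb5
  -- the member constants below K₆ and the rates above δ
  have hS0 : 0 ≤ B₂ + B₄ := add_nonneg hB₂ hB₄
  have hKp0 : 0 ≤ constKp B₂ B₄ θ₂' c := (constP_nonneg_le hθ₂' hc hq₂1 hS0 hS0 hS0 le_rfl le_rfl le_rfl).1
  have hKG0 : 0 ≤ constG46 (constKp B₂ B₄ θ₂' c) c := constG46_nonneg hKp0 hc
  have hK0le : Csup * Λ₁ ≤ K6 := (mul_le_mul_of_nonneg_left hΛ₁le hCsup0).trans hK6a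
  have hKhle : Csup * Λh ≤ K6 := (mul_le_mul_of_nonneg_left hΛhle hCsup0).trans hK6a
  have hK4le : constG46 (constKp B₂ B₄ θ₂' c) c ≤ K6 := hKGle.trans hK6b
  have hK3le : NP * (constG46 (constKp B₂ B₄ θ₂' c) c * Λ₁) ≤ K6 :=
    (mul_le_mul_of_nonneg_left (mul_le_mul hKGle hΛ₁le hΛ₁0 hKGu0) hNP0).trans hK6c
  have hK5le : NP * (constG46 (constKp B₂ B₄ θ₂' c) c * Λm) ≤ K6 :=
    (mul_le_mul_of_nonneg_left (mul_le_mul hKGle hΛmle hΛm0 hKGu0) hNP0).trans hK6c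
  have hexp : ∀ {r₁ : ℝ}, δ ≤ r₁ → ∀ y y' : g.Site, Real.exp (-(r₁ * g.dist y y')) ≤ Real.exp (-(δ * g.dist y y')) :=
    fun h y y' => Real.exp_le_exp.mpr (neg_le_neg (mul_le_mul_of_nonneg_right h (hG.dnn y y')))
  have hP : ∀ t : ℝ, B9.pref6 t 0 = t ^ 2 ∧ B9.pref6 t 1 = t ∧ B9.pref6 t 2 = t ∧ B9.pref6 t 3 = 1 ∧ B9.pref6 t 4 = 1 ∧
      B9.pref6 t 5 = 1 := fun t => by simp [B9.pref6]
  have hB0 : BlockBd (g := toB6 g R₀ H₀) 𝔬.blk 𝔬.blk (𝔬.GG U)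
      (fun (y y' : g.Site) => K6 * B9.pref6 (g.len y) 0 * Real.exp (-(δ * g.dist y y'))) := by
    refine hb0.mono fun y y' => ?_
    rw [(hP (g.len y)).1]
    calc Csup * Λ₁ * g.len y ^ 2 * Real.exp (-((1 - α) * ρ' * g.dist y y'))
        ≤ K6 * g.len y ^ 2 * Real.exp (-((1 - α) * ρ' * g.dist y y')) :=
          mul_le_mul_of_nonneg_right (mul_le_mul_of_nonneg_right hK0le (sq_nonneg _)) (Real.exp_nonneg _)
      _ ≤ K6 * g.len y ^ 2 * Real.exp (-(δ * g.dist y y')) := mul_le_mul_of_nonneg_left (hexp hδ1 y y') (mul_nonneg hK60 (sq_nonneg _))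
  have hB1 : BlockBd (g := toB6 g R₀ H₀) 𝔬.blk 𝔬.blkY (𝔬.D U ∘ₗ 𝔬.GG U)
      (fun (y y' : g.Site) => K6 * B9.pref6 (g.len y) 1 * Real.exp (-(δ * g.dist y y'))) := by
    refine hb1.mono fun y y' => ?_
    rw [(hP (g.len y)).2.1]
    calc Csup * Λh * g.len y * Real.exp (-((1 - α) * ρ' * g.dist y y'))
        ≤ K6 * g.len y * Real.exp (-((1 - α) * ρ' * g.dist y y')) :=
          mul_le_mul_of_nonneg_right (mul_le_mul_of_nonneg_right hKhle (hlen y)) (Real.exp_nonneg _)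
      _ ≤ K6 * g.len y * Real.exp (-(δ * g.dist y y')) := mul_le_mul_of_nonneg_left (hexp hδ1 y y') (mul_nonneg hK60 (hlen y))
  have hB2 : BlockBd (g := toB6 g R₀ H₀) 𝔬.blkY 𝔬.blk (𝔬.GG U ∘ₗ 𝔬.Dstar U)
      (fun (y y' : g.Site) => K6 * B9.pref6 (g.len y) 2 * Real.exp (-(δ * g.dist y y'))) := by
    refine hb2.mono fun y y' => ?_
    rw [(hP (g.len y)).2.2.1]
    calc Csup * Λh * g.len y * Real.exp (-((1 - α) * ρ' * g.dist y y'))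
        ≤ K6 * g.len y * Real.exp (-((1 - α) * ρ' * g.dist y y')) :=
          mul_le_mul_of_nonneg_right (mul_le_mul_of_nonneg_right hKhle (hlen y)) (Real.exp_nonneg _)
      _ ≤ K6 * g.len y * Real.exp (-(δ * g.dist y y')) := mul_le_mul_of_nonneg_left (hexp hδ1 y y') (mul_nonneg hK60 (hlen y))
  have hB3 : BlockBd (g := toB6 g R₀ H₀) 𝔬.blk (𝔬.blk ∘ Prod.fst) (familyOp (fun q : P × P => (Dd U q.1 ∘ₗ Dd U q.2) ∘ₗ 𝔬.GG U))
      (fun (y y' : g.Site) => K6 * B9.pref6 (g.len y) 3 * Real.exp (-(δ * g.dist y y'))) := by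
    refine hb3.mono fun y y' => ?_
    rw [(hP (g.len y)).2.2.2.1, mul_one]
    calc NP * (constG46 (constKp B₂ B₄ θ₂' c) c * Λ₁ * Real.exp (-((1 - α) * ρ' * g.dist y y')))
        = NP * (constG46 (constKp B₂ B₄ θ₂' c) c * Λ₁) * Real.exp (-((1 - α) * ρ' * g.dist y y')) := by ring
      _ ≤ K6 * Real.exp (-(δ * g.dist y y')) := mul_le_mul hK3le (hexp hδ1 y y') (Real.exp_nonneg _) hK60
  have hB4 : BlockBd (g := toB6 g R₀ H₀) 𝔬.blkY 𝔬.blkY (𝔬.D U ∘ₗ (𝔬.GG U ∘ₗ 𝔬.Dstar U))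
      (fun (y y' : g.Site) => K6 * B9.pref6 (g.len y) 4 * Real.exp (-(δ * g.dist y y'))) := by
    refine hb4.mono fun y y' => ?_
    rw [(hP (g.len y)).2.2.2.2.1, mul_one]
    exact mul_le_mul hK4le (hexp hδ2 y y') (Real.exp_nonneg _) hK60
  have hB5 : BlockBd (g := toB6 g R₀ H₀) 𝔬.blk (𝔬.blk ∘ Prod.fst) (familyOp (fun q : P × P => 𝔬.GG U ∘ₗ (Dds U q.1 ∘ₗ Dds U q.2)))
      (fun (y y' : g.Site) => K6 * B9.pref6 (g.len y) 5 * Real.exp (-(δ * g.dist y y'))) := by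
    refine hb5.mono fun y y' => ?_
    rw [(hP (g.len y)).2.2.2.2.2, mul_one]
    calc NP * (constG46 (constKp B₂ B₄ θ₂' c) c * Λm * Real.exp (-((1 - α) * ρ' * g.dist y y')))
        = NP * (constG46 (constKp B₂ B₄ θ₂' c) c * Λm) * Real.exp (-((1 - α) * ρ' * g.dist y y')) := by ring
      _ ≤ K6 * Real.exp (-(δ * g.dist y y')) := mul_le_mul hK5le (hexp hδ1 y y') (Real.exp_nonneg _) hK60
  exact ⟨hB0, hB1, hB2, hB3, hB4, hB5⟩

/-! ## §2 The L² block (3.46) of a kernel family co-read by 𝔊, at the entry line -/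

omit [Fintype PX] [Fintype PY] in
/-- ★★ **THEOREM 3.13 — THE L² BLOCK (3.46) OF A KERNEL FAMILY CO-READ ON THE NEIGHBOURHOOD BY THE MODELS OF 𝔊, AT THE ENTRY LINE** (`GG_l2Block_pairMZc` with the three sup
entries of 𝔊 as HYPOTHESES): `L2Block K (mN·m·Cev·CL²·e^{rδ}·K₆) δ U` from §1, the mixed pair family (`GG_l2bd_mixedFamily_cut_of_letters`) and n06-k's `l2line_of_blockBd_nbr`.
[cite: Balaban1985BackgroundPropagators, Thm 3.13 p.426 + (3.152)–(3.153) p.426 + (3.46) p.398 + (3.39) p.397; Balaban1984PropagatorsII, (2.51)–(2.52) p.232] -/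
theorem GG_l2Block_of_entries (hG : GeoOK g) {K : B9.KernelFamily g B} {𝔬 : Ops g B X Y Z W}
    {Dd Dds : B.Cfg → P → Module.End ℝ (X → ℝ)} {U : B.Cfg}
    (Rel : g.Site → g.Site → Prop) [DecidableRel Rel] (ev : g.Loc → X → ℝ) (evY : g.Loc → Y → ℝ) {m mN : ℕ}
    {r Cev CL θ₂' B₂ B₄ ρ ρ' α σ c Csup KGu K6 Λ₁ Λh Λm Λu δ : ℝ}
    (hrow : RowSum (toB6 g R₀ H₀) σ c) (hc : 0 ≤ c) (hθ₂' : 0 ≤ θ₂') (hB₂ : 0 ≤ B₂)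
    (hB₄ : 0 ≤ B₄) (hσ : 0 ≤ σ) (hρ' : 0 < ρ') (hρ'ρ₅ : ρ' + 5 * σ ≤ ρ)
    (hq₂1 : B₂ * θ₂' * c * c < 1) (hδ0 : 0 ≤ δ) (hδ1 : δ ≤ (1 - α) * ρ')
    (hδ2 : δ ≤ ρ')
    (hST1 : ScaleTransfer g ρ' α Λ₁ (fun y => g.len y ^ (1 : ℝ))) (hSTh : ScaleTransfer g ρ' α Λh (fun y => g.len y ^ (1 / 2 : ℝ)))
    (hSTm : ScaleTransfer g ρ' α Λm (fun y => g.len y ^ (-1 : ℝ))) (hΛ₁0 : 0 ≤ Λ₁) (hΛ₁le : Λ₁ ≤ Λu) (hΛhle : Λh ≤ Λu)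
    (hΛm0 : 0 ≤ Λm) (hΛmle : Λm ≤ Λu) (h1Λu : 1 ≤ Λu)
    (hCsup0 : 0 ≤ Csup)
    (hKGu0 : 0 ≤ KGu) (hKGle : constG46 (constKp B₂ B₄ θ₂' c) c ≤ KGu) (hK60 : 0 ≤ K6) (hK6a : Csup * Λu ≤ K6) (hK6b : KGu ≤ K6)
    (hK6c : Real.sqrt (Fintype.card (P × P)) * (KGu * Λu) ≤ K6)
    (hm0 : HasMajorant (g := toB6 g R₀ H₀) 𝔬.blk (𝔬.GG U) (fun a b => Csup * g.len a ^ 2 * Real.exp (-(ρ' * g.dist a b))))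
    (hm1 : HasMajorantHom (g := toB6 g R₀ H₀) 𝔬.blk 𝔬.blkY (𝔬.D U ∘ₗ 𝔬.GG U)
      (fun (a b : g.Site) => Csup * g.len a * Real.exp (-(ρ' * g.dist a b))))
    (hm2 : HasMajorantHom (g := toB6 g R₀ H₀) 𝔬.blkY 𝔬.blk (𝔬.GG U ∘ₗ 𝔬.Dstar U)
      (fun (a b : g.Site) => Csup * g.len a * Real.exp (-(ρ' * g.dist a b))))
    (hI : Identities 𝔬 U)
    (hL2 : Thm33G0L2M 𝔬 Dd Dds R₀ H₀ B₂ ρ U)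
    (hT : BlockBd (g := toB6 g R₀ H₀) 𝔬.blk 𝔬.blk (𝔬.Tpi U + 𝔬.T2 U)
      (fun (y y' : g.Site) => θ₂' * (g.len y)⁻¹ * (g.len y')⁻¹ * Real.exp (-(ρ * g.dist y y'))))
    {vZ : g.Site → ℝ} {hvZ : ∀ y, 0 < vZ y}
    (hLt : Letters313L2Pc 𝔬 Dd Dds R₀ H₀ B₄ ρ vZ hvZ U) (hLM : Letters313L2MZ 𝔬 Dd Dds R₀ H₀ B₄ ρ vZ hvZ U)
    (hsym : IsTransposePair (𝔬.GG U) (𝔬.GG U)) (htr : IsTransposePair (𝔬.D U ∘ₗ 𝔬.GG U) (𝔬.GG U ∘ₗ 𝔬.Dstar U))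
    (hRd₂ : ∀ a b b', Rel b b' → g.dist a b = g.dist a b')
    (hmult : ∀ y' : g.Site, (Finset.univ.filter (fun y'' => Rel y'' y')).card ≤ m)
    (hnbr : ∀ y : g.Site, (nbr g r y).card ≤ mN)
    (hCL1 : 1 ≤ CL) (hCL : ∀ a a' : g.Site, g.dist a a' ≤ r → g.len a ≤ CL * g.len a') (hCev : 0 ≤ Cev)
    (hl0 : L2ReadsNbr (R := R₀) (H := H₀) K 0 U Rel r Cev 𝔬.blk 𝔬.blk ev (𝔬.GG U))
    (hl1 : L2ReadsNbr (R := R₀) (H := H₀) K 1 U Rel r Cev 𝔬.blkY 𝔬.blk ev (𝔬.D U ∘ₗ 𝔬.GG U))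
    (hl2 : L2ReadsNbr (R := R₀) (H := H₀) K 2 U Rel r Cev 𝔬.blk 𝔬.blkY evY (𝔬.GG U ∘ₗ 𝔬.Dstar U))
    (hl3 : L2ReadsNbr (R := R₀) (H := H₀) K 3 U Rel r Cev (𝔬.blk ∘ Prod.fst) 𝔬.blk ev
      (familyOp (fun q : P × P => Dd U q.1 ∘ₗ (𝔬.GG U ∘ₗ Dds U q.2))))
    (hl4 : L2ReadsNbr (R := R₀) (H := H₀) K 4 U Rel r Cev (𝔬.blk ∘ Prod.fst) 𝔬.blk ev
      (familyOp (fun q : P × P => (Dd U q.1 ∘ₗ Dd U q.2) ∘ₗ 𝔬.GG U)))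
    (hl5 : L2ReadsNbr (R := R₀) (H := H₀) K 5 U Rel r Cev (𝔬.blk ∘ Prod.fst) 𝔬.blk ev
      (familyOp (fun q : P × P => 𝔬.GG U ∘ₗ (Dds U q.1 ∘ₗ Dds U q.2)))) :
    L2Block K (mN * m * Cev * CL ^ 2 * Real.exp (r * δ) * K6) δ U := by
  obtain ⟨hB0, hB1, hB2, hB4f, -, hB5f⟩ := GG_blockBds_of_entries hG hrow hc hθ₂' hB₂ hB₄ hσ hρ' hρ'ρ₅
    hq₂1 hδ1 hδ2 hST1 hSTh hSTm hΛ₁0 hΛ₁le hΛhle hΛm0 hΛmle h1Λu hCsup0 hKGu0 hKGle hK60 hK6a hK6b hK6c hm0 hm1 hm2 hI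
    hL2.toThm33G0L2P hT hLt hsym htr
  -- the mixed pair family of 𝔊 at the rate ρ′, brought to (K₆, δ)
  have hS0 : 0 ≤ B₂ + B₄ := add_nonneg hB₂ hB₄
  have hKp0 : 0 ≤ constKp B₂ B₄ θ₂' c := (constP_nonneg_le hθ₂' hc hq₂1 hS0 hS0 hS0 le_rfl le_rfl le_rfl).1
  have hKG0 : 0 ≤ constG46 (constKp B₂ B₄ θ₂' c) c := constG46_nonneg hKp0 hc
  have hNP0 : 0 ≤ Real.sqrt (Fintype.card (P × P)) := Real.sqrt_nonneg _
  have hΛu0 : 0 ≤ Λu := zero_le_one.trans h1Λu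
  have hK3le : Real.sqrt (Fintype.card (P × P)) * constG46 (constKp B₂ B₄ θ₂' c) c ≤ K6 := by
    have h1 : constG46 (constKp B₂ B₄ θ₂' c) c ≤ KGu * Λu := hKGle.trans (le_mul_of_one_le_right hKGu0 h1Λu)
    exact (mul_le_mul_of_nonneg_left h1 hNP0).trans hK6c
  have hexp : ∀ {r₁ : ℝ}, δ ≤ r₁ → ∀ y y' : g.Site, Real.exp (-(r₁ * g.dist y y')) ≤ Real.exp (-(δ * g.dist y y')) :=
    fun h y y' => Real.exp_le_exp.mpr (neg_le_neg (mul_le_mul_of_nonneg_right h (hG.dnn y y')))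
  have hb3 := GG_l2bd_mixedFamily_cut_of_letters hG hrow hc hB₂ hB₄ hθ₂' hρ'.le hσ hρ'ρ₅ hL2 hT hLt.gDv hLt.gQs hLt.c1 hLt.q hLM hI hq₂1
  have hP3 : ∀ t : ℝ, B9.pref6 t 3 = 1 := fun t => by simp [B9.pref6]
  have hB3f : BlockBd (g := toB6 g R₀ H₀) 𝔬.blk (𝔬.blk ∘ Prod.fst) (familyOp (fun q : P × P => Dd U q.1 ∘ₗ (𝔬.GG U ∘ₗ Dds U q.2)))
      (fun (y y' : g.Site) => K6 * B9.pref6 (g.len y) 3 * Real.exp (-(δ * g.dist y y'))) := by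
    refine hb3.mono fun y y' => ?_
    rw [hP3, mul_one]
    calc Real.sqrt (Fintype.card (P × P)) * (constG46 (constKp B₂ B₄ θ₂' c) c * Real.exp (-(ρ' * g.dist y y')))
        = Real.sqrt (Fintype.card (P × P)) * constG46 (constKp B₂ B₄ θ₂' c) c * Real.exp (-(ρ' * g.dist y y')) := by ring
      _ ≤ K6 * Real.exp (-(δ * g.dist y y')) := mul_le_mul hK3le (hexp hδ2 y y') (Real.exp_nonneg _) hK60
  -- the record order: 3 = the mixed pair family, 4 = ∇∇𝔊 (pref6 = 1 on both)
  have hP34 : ∀ t : ℝ, B9.pref6 t 3 = B9.pref6 t 4 := fun t => by simp [B9.pref6]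
  have hB4f' : BlockBd (g := toB6 g R₀ H₀) 𝔬.blk (𝔬.blk ∘ Prod.fst) (familyOp (fun q : P × P => (Dd U q.1 ∘ₗ Dd U q.2) ∘ₗ 𝔬.GG U))
      (fun (y y' : g.Site) => K6 * B9.pref6 (g.len y) 4 * Real.exp (-(δ * g.dist y y'))) :=
    hB4f.mono fun y y' => by rw [hP34]
  intro n
  fin_cases n
  · exact l2line_of_blockBd_nbr hl0 hRd₂ hmult hnbr hCL1 hCL hG.tri hG.symm hK60 hδ0 hCev hG.lenle hB0
  · exact l2line_of_blockBd_nbr hl1 hRd₂ hmult hnbr hCL1 hCL hG.tri hG.symm hK60 hδ0 hCev hG.lenle hB1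
  · exact l2line_of_blockBd_nbr hl2 hRd₂ hmult hnbr hCL1 hCL hG.tri hG.symm hK60 hδ0 hCev hG.lenle hB2
  · exact l2line_of_blockBd_nbr hl3 hRd₂ hmult hnbr hCL1 hCL hG.tri hG.symm hK60 hδ0 hCev hG.lenle hB3f
  · exact l2line_of_blockBd_nbr hl4 hRd₂ hmult hnbr hCL1 hCL hG.tri hG.symm hK60 hδ0 hCev hG.lenle hB4f'
  · exact l2line_of_blockBd_nbr hl5 hRd₂ hmult hnbr hCL1 hCL hG.tri hG.symm hK60 hδ0 hCev hG.lenle hB5f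

end OneMember

end

end Literature.MathematicalPhysics.QuantumFieldTheory.Balaban1983to89.B9Thm313WholeGGBlocksEntries
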